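import Mathlib
import HarnessLib
import Summits.BirchSwinnertonDyer.BirchSwinnertonDyer.Theses.ManinLocalTwoThree
import Summits.BirchSwinnertonDyer.BirchSwinnertonDyer.Theorems.ManinLocalTwoThreeCDivisionAssembly
import Literature.NumberTheory.Automorphic.UnboundedDenominators

/-!
# Lines/cdivision_udc.lean — v1 (p3 gen 18 for the C3 chain, 2026-08-30T01:xxZ; design -an g44 MEMO-an §89 «THE c-DIVISION WITNESS»):
# C3 `ManinPrimeToThreeAtNine` ⟸ THE PRINTED CDT FACT ALONE.
# The analytic witness is no longer a stub: `CDivAssembly.exists_cDivisionWitness` (kernel; nodes N1–N5 p2 g20, N6–N7 p3 g18) gives, for EVERY X₀(N)-datum of a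
# globally minimal curve, a holomorphic `F = 12·℘_{Λ_W}(ℰ_f)·G·Δ^a` (x-coordinate of the c-division point `H = u_W∘ℰ_f`, `[c]H = φ`; Honda at 1) with
# Γ₀(N)-stabiliser EXACTLY `Γ^{(c)} = {γ : {∞,γ∞}_f ∈ Λ_W}`, bounded at the cusps, integer q-expansion.  CDT ⟹ `F` congruence ⟹ `Γ(MN) ≤ Γ^{(c)} ≤ Γ^{(3)}`
# (3 ∣ c) ⟹ index-9 configuration `Λ₁ = 3Λ₀` ⟹ impossible (`not_periodLatticeGamma1_eq_three_mul_periodLattice`).  COMPOSITION `CDivAssembly.maninPrimeToThreeAtNine_of_CDT`.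
# STUBS (1): `stub_CDT_algInt` (PRINTED, cite-only: Calegari–Dimitrov–Tang 2025, Thm. 1.0.1 with Remarks 58–59 — Unbounded Denominators, all weights,
# algebraic-integer coefficients).  Versus thirding_udc v1: its OPEN analytic stub `stub_thirdingWitnessLaw` is GONE (replaced by a kernel theorem on the
# c-division cover; the 3-division witness t(Q)·B_d of v1 had a pole mismatch, -an 00:06Z / p3 00:18Z).
# HONEST FRAMING: CONDITIONAL reduction — C3 holds modulo the printed CDT theorem, which is NOT proved in the tree; BSD is not proved; Manin's conjecture at 3
# is not proved unconditionally.
-/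

set_option autoImplicit false
set_option linter.dupNamespace false

noncomputable section

namespace Summit.BirchSwinnertonDyer.BirchSwinnertonDyer.Cruxes.ManinPrimeToThreeAtNine.CDivisionUDC

/-- STUB (PRINTED) CDT-algInt — Calegari–Dimitrov–Tang 2025 Thm. 1.0.1 with Remarks 58–59 (Unbounded Denominators for noncongruence modular forms of every
integral weight with algebraic-integer Fourier coefficients); CITE-ONLY. [cite: CalegariDimitrovTang2025, Thm. 1.0.1 and Remarks 58–59] -/
theorem stub_CDT_algInt : Literature.NumberTheory.Automorphic.CalegariDimitrovTang2025_unboundedDenominators_algInt := by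
  sorry

/-- COMPOSITION (no sorry): `CDivAssembly.maninPrimeToThreeAtNine_of_CDT` (p3 g18; c-division witness of -an g44, nodes p2 g20 / p3 g18). -/
theorem ManinPrimeToThreeAtNine_of :
    Summit.BirchSwinnertonDyer.BirchSwinnertonDyer.Theses.ManinLocalTwoThree.ManinPrimeToThreeAtNine :=
  Summit.BirchSwinnertonDyer.BirchSwinnertonDyer.Theorems.ManinLocalTwoThree.CDivAssembly.maninPrimeToThreeAtNine_of_CDT stub_CDT_algInt

end Summit.BirchSwinnertonDyer.BirchSwinnertonDyer.Cruxes.ManinPrimeToThreeAtNine.CDivisionUDC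

end
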